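import Summits.HubbardSuperconductivity.HubbardSuperconductivity.Theorems.AnisotropyChordFourTorusEncoding
import Summits.HubbardSuperconductivity.HubbardSuperconductivity.Theorems.AnisotropyChordFourTorusKernelNine
import Summits.HubbardSuperconductivity.HubbardSuperconductivity.Theorems.AnisotropyChordTowerBridge
import Summits.HubbardSuperconductivity.HubbardSuperconductivity.Theorems.AnisotropyChordFourTorusKernelMatrix
import Summits.HubbardSuperconductivity.HubbardSuperconductivity.Theorems.AnisotropyChordTowerEdgeSectors

/-!
# Route `AnisotropyChord` / crux `FerroSideChord` at `M = 4`: CLASS VALUES, SECTOR SUMS, THE ISING DIAGONAL AND THE ENERGY BOUNDS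
(prover seat `hubbard-h0-rotor-p1` g17)

For the sector-`0` Perron amplitude `a` of `H₄(Δ)` (class values `v r = a (decode (rep8 r))`):
* `classValue` (kernel witnesses `check8_lo/hi` + `perron_decode_actCode`), `rep9_facts`; `n8_eq_card`, `n9_eq_card` (packed counts ARE
  the class cardinalities: `counts8_eq`/`counts9_eq` + `field_extract`); `sum_sector8`, `sum_sector9`; `sum_sq_eq_classes` (`Σa² = Σ n8 v²`);
* `brokenOrd` is a class function, at the representative it is the kernel's `activeEdges r`; `sum_isingW_sq_eq_classes`
  (`Σ_σ W(σ) a σ² = Σ_r n8 r (8 − A_r/2) v_r²`); `perron_energy_four` (`Σ a(Aa + (1−Δ)Wa) = E₀(Δ) + 8`);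
  **`sectorE_le_uniform`**: Rayleigh–Ritz with the uniform amplitude, `E₀(Δ) + 8 ≤ −(8/15)(1−Δ)` (kernel totals `12870`, `219648`).
-/

set_option linter.style.longLine false
set_option linter.dupNamespace false
set_option autoImplicit false

open Finset
open Literature.MathematicalPhysics.QuantumLattice Literature.Probability.LatticeModels
open Summit.HubbardSuperconductivity.HubbardSuperconductivity.Theorems.AnisotropyChord.Tower
open Summit.HubbardSuperconductivity.HubbardSuperconductivity.Theorems.AnisotropyChord.InsertionEntropy

namespace Summit.HubbardSuperconductivity.HubbardSuperconductivity.Theorems.AnisotropyChord.FourTorus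


/-! ## Support -/

/-- `|V| = 16`. [folklore] -/
theorem card_V4 : Fintype.card V4 = 16 := by rw [Fintype.card_congr siteEquiv, Fintype.card_fin]

/-- a Perron amplitude of the sector `M` lives on the codes of weight `8 − M`. [folklore] -/
theorem bitCount_of_perron_ne_zero {Δ M : ℝ} {a : Cfg → ℝ} (ha : IsPerronSectorGroundAmplitude 4 Δ M a) (k : ℕ)
    (hk : a (decode k) ≠ 0) : (bitCount k : ℝ) = 8 - M := by
  have h := perron_support ha (decode k) hk
  rw [zerosCard_decode, card_V4] at h
  push_cast at h
  linarith

/-- the sector-`0` amplitude vanishes off the weight-8 codes. [folklore] -/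
theorem perron_decode_eq_zero {Δ : ℝ} {a : Cfg → ℝ} (ha : IsPerronSectorGroundAmplitude 4 Δ 0 a) {k : ℕ} (hk : k < 65536)
    (hpop : pop16 k ≠ 8) : a (decode k) = 0 := by
  by_contra hne
  have h := bitCount_of_perron_ne_zero ha k hne
  rw [← pop16_eq_bitCount k hk] at h
  have : pop16 k = 8 := by exact_mod_cast (by linarith : (pop16 k : ℝ) = 8)
  exact hpop this

/-! ## Class values via the kernel witnesses -/

/-- the kernel fact `check8`, unpacked. [folklore] -/
theorem check8_facts {k : ℕ} (hk : k < 65536) (hpop : pop16 k = 8) :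
    cls k < 58 ∧ wit8 k < 768 ∧ actCode (wit8 k) (rep8 (cls k)) = k := by
  have h := all16_sound check8_lo check8_hi k hk
  unfold ok8 at h
  rw [hpop] at h
  simpa [Bool.and_eq_true, decide_eq_true_eq, beq_iff_eq, and_assoc] using h

/-- the kernel fact `check9`, unpacked. [folklore] -/
theorem check9_facts {k : ℕ} (hk : k < 65536) (hpop : pop16 k = 9) :
    cls9 k < 56 ∧ wit9 k < 768 ∧ wit9 k % 2 = 0 ∧ actCode (wit9 k) (rep9 (cls9 k)) = k := by
  have h := all16_sound check9_lo check9_hi k hk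
  unfold ok9 at h
  rw [hpop] at h
  simpa [Bool.and_eq_true, decide_eq_true_eq, beq_iff_eq, and_assoc] using h

/-- **class value:** on a weight-8 code the sector-`0` Perron amplitude equals its value at the class representative. [folklore] -/
theorem classValue {Δ : ℝ} {a : Cfg → ℝ} (ha : IsPerronSectorGroundAmplitude 4 Δ 0 a) {k : ℕ} (hk : k < 65536)
    (hpop : pop16 k = 8) : a (decode k) = a (decode (rep8 (cls k))) := by
  obtain ⟨-, hw, hact⟩ := check8_facts hk hpop
  have h := perron_decode_actCode ha hw (rep8 (cls k))
  rwa [hact] at h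

/-- the kernel fact `rep9_spec`, unpacked. [folklore] -/
theorem rep9_facts {ρ : ℕ} (hρ : ρ < 56) :
    pop16 (rep9 ρ) = 9 ∧ cls9 (rep9 ρ) = ρ ∧ rep9 ρ < 65536 ∧
      ∀ i < 16, Nat.testBit (rep9 ρ) i = true → pop16 (rep9 ρ ^^^ 2 ^ i) = 8 ∧ rep9 ρ ^^^ 2 ^ i < 65536 := by
  have h := allN_sound rep9_spec ρ hρ
  simp only [Bool.and_eq_true, decide_eq_true_eq, beq_iff_eq] at h
  obtain ⟨⟨⟨h1, h2⟩, h3⟩, h4⟩ := h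
  refine ⟨h1, h2, h3, fun i hi hb => ?_⟩
  have h5 := allN_sound h4 i hi
  rw [hb] at h5
  simpa [Bool.and_eq_true, decide_eq_true_eq, beq_iff_eq] using h5


/-! ## The packed counts are the class cardinalities -/

/-- the weight-8 class cardinality. [folklore] -/
def card8 (r : ℕ) : ℕ := ((range 65536).filter fun k => pop16 k = 8 ∧ cls k = r).card
/-- the weight-9 class cardinality. [folklore] -/
def card9 (r : ℕ) : ℕ := ((range 65536).filter fun k => pop16 k = 9 ∧ cls9 k = r).card

/-- `sum16 ind8` as a fiberwise power sum. [folklore] -/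
theorem sum16_ind8_eq : sum16 ind8 = ∑ r ∈ range 58, card8 r * 2 ^ (17 * r) := by
  rw [sum16_eq]
  have h1 : ∀ k, ind8 k = if pop16 k = 8 then 2 ^ (17 * cls k) else 0 := by
    intro k; unfold ind8
    by_cases h : pop16 k = 8
    · rw [if_pos h, show (pop16 k == 8) = true from beq_iff_eq.2 h]; rfl
    · rw [if_neg h, show (pop16 k == 8) = false from beq_eq_false_iff_ne.2 h]; rfl
  simp_rw [h1]
  exact sum_indicator_pow_eq 17 58 65536 (fun k => pop16 k = 8) cls
    (fun k hk hp => (check8_facts (mem_range.1 (mem_range.2 hk)) hp).1)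

/-- `sum16 ind9` as a fiberwise power sum. [folklore] -/
theorem sum16_ind9_eq : sum16 ind9 = ∑ r ∈ range 56, card9 r * 2 ^ (17 * r) := by
  rw [sum16_eq]
  have h1 : ∀ k, ind9 k = if pop16 k = 9 then 2 ^ (17 * cls9 k) else 0 := by
    intro k; unfold ind9
    by_cases h : pop16 k = 9
    · rw [if_pos h, show (pop16 k == 9) = true from beq_iff_eq.2 h]; rfl
    · rw [if_neg h, show (pop16 k == 9) = false from beq_eq_false_iff_ne.2 h]; rfl
  simp_rw [h1]
  exact sum_indicator_pow_eq 17 56 65536 (fun k => pop16 k = 9) cls9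
    (fun k hk hp => (check9_facts (mem_range.1 (mem_range.2 hk)) hp).1)

/-- class cardinalities are `< 2^17`. [folklore] -/
theorem card8_lt (r : ℕ) : card8 r < 2 ^ 17 :=
  lt_of_le_of_lt (Finset.card_filter_le _ _) (by simp)
/-- class cardinalities are `< 2^17`. [folklore] -/
theorem card9_lt (r : ℕ) : card9 r < 2 ^ 17 :=
  lt_of_le_of_lt (Finset.card_filter_le _ _) (by simp)

/-- **`n8 r` is the cardinality of the weight-8 class `r`.** [folklore] -/
theorem n8_eq_card {r : ℕ} (hr : r < 58) : n8 r = card8 r := by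
  unfold n8; rw [← counts8_eq, sum16_ind8_eq]; exact field_extract 17 card8 card8_lt 58 r hr

/-- **`n9 ρ` is the cardinality of the weight-9 class `ρ`.** [folklore] -/
theorem n9_eq_card {r : ℕ} (hr : r < 56) : n9 r = card9 r := by
  unfold n9; rw [← counts9_eq, sum16_ind9_eq]; exact field_extract 17 card9 card9_lt 56 r hr

/-! ## Sector sums regrouped by classes -/

/-- **weight-8 regrouping:** `Σ_{k<2^16, weight 8} g (cls k) = Σ_{r<58} n8 r · g r`. [folklore] -/
theorem sum_sector8 (g : ℕ → ℝ) :
    ∑ k ∈ range 65536, (if pop16 k = 8 then g (cls k) else 0) = ∑ r ∈ range 58, (n8 r : ℝ) * g r := by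
  have hf : ∑ k ∈ (range 65536).filter (fun k => pop16 k = 8), g (cls k)
      = ∑ k ∈ range 65536, (if pop16 k = 8 then g (cls k) else 0) := Finset.sum_filter _ _
  rw [← hf]
  rw [← Finset.sum_fiberwise_of_maps_to (s := (range 65536).filter fun k => pop16 k = 8) (t := range 58) (g := cls)
      (fun k hk => by
        rw [Finset.mem_filter, Finset.mem_range] at hk
        exact mem_range.2 (check8_facts hk.1 hk.2).1)]
  refine Finset.sum_congr rfl fun r hr => ?_
  rw [Finset.sum_congr rfl (g := fun _ => g r) (fun k hk => by rw [(Finset.mem_filter.1 hk).2]),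
    Finset.sum_const, nsmul_eq_mul, n8_eq_card (mem_range.1 hr)]
  rw [Finset.filter_filter]
  rfl

/-- **weight-9 regrouping:** `Σ_{k<2^16, weight 9} g (cls9 k) = Σ_{ρ<56} n9 ρ · g ρ`. [folklore] -/
theorem sum_sector9 (g : ℕ → ℝ) :
    ∑ k ∈ range 65536, (if pop16 k = 9 then g (cls9 k) else 0) = ∑ r ∈ range 56, (n9 r : ℝ) * g r := by
  have hf : ∑ k ∈ (range 65536).filter (fun k => pop16 k = 9), g (cls9 k)
      = ∑ k ∈ range 65536, (if pop16 k = 9 then g (cls9 k) else 0) := Finset.sum_filter _ _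
  rw [← hf]
  rw [← Finset.sum_fiberwise_of_maps_to (s := (range 65536).filter fun k => pop16 k = 9) (t := range 56) (g := cls9)
      (fun k hk => by
        rw [Finset.mem_filter, Finset.mem_range] at hk
        exact mem_range.2 (check9_facts hk.1 hk.2).1)]
  refine Finset.sum_congr rfl fun r hr => ?_
  rw [Finset.sum_congr rfl (g := fun _ => g r) (fun k hk => by rw [(Finset.mem_filter.1 hk).2]),
    Finset.sum_const, nsmul_eq_mul, n9_eq_card (mem_range.1 hr)]
  rw [Finset.filter_filter]
  rfl

/-- **the norm in class variables:** `Σ_σ a σ² = Σ_{r<58} n8 r · v r²`, `v r = a (decode (rep8 r))`. [folklore] -/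
theorem sum_sq_eq_classes {Δ : ℝ} {a : Cfg → ℝ} (ha : IsPerronSectorGroundAmplitude 4 Δ 0 a) :
    ∑ σ, a σ ^ 2 = ∑ r ∈ range 58, (n8 r : ℝ) * a (decode (rep8 r)) ^ 2 := by
  rw [sum_config_eq_sum_range, ← sum_sector8]
  refine Finset.sum_congr rfl fun k hk => ?_
  by_cases hp : pop16 k = 8
  · rw [if_pos hp, classValue ha (mem_range.1 hk) hp]
  · rw [if_neg hp, perron_decode_eq_zero ha (mem_range.1 hk) hp]; ring




/-! ## Sums over sites through `siteEquiv` -/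

/-- `Σ_{x : V4} f (siteEquiv x) = Σ_{i<16} f i`. [folklore] -/
theorem sum_V4_eq {β : Type} [AddCommMonoid β] (f : ℕ → β) : ∑ x : V4, f (siteEquiv x) = ∑ i ∈ range 16, f i := by
  rw [← Fin.sum_univ_eq_sum_range (fun i => f i) 16]
  exact Equiv.sum_comp siteEquiv (fun i : Fin 16 => f i)

/-! ## The broken-bond count is a class function -/

section General
variable {V : Type} [Fintype V] [DecidableEq V] (G : SimpleGraph V) [DecidableRel G.Adj]

omit [DecidableEq V] in
/-- `brokenOrd` is invariant under graph automorphisms. [folklore] -/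
theorem brokenOrd_comp_iso (φ : G ≃g G) (σ : V → Fin 2) : brokenOrd G (σ ∘ ⇑φ) = brokenOrd G σ := by
  unfold brokenOrd
  symm
  rw [← Equiv.sum_comp φ.toEquiv]
  refine Finset.sum_congr rfl fun x _ => ?_
  rw [← Equiv.sum_comp φ.toEquiv]
  refine Finset.sum_congr rfl fun y _ => ?_
  have hadj : G.Adj (φ x) (φ y) ↔ G.Adj x y := φ.map_adj_iff
  have hx : φ.toEquiv x = φ x := rfl
  have hy : φ.toEquiv y = φ y := rfl
  rw [hx, hy]
  by_cases h1 : G.Adj x y <;> by_cases h2 : σ (φ x) = 0 <;> by_cases h3 : σ (φ y) = 1 <;>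
    simp [Function.comp_apply, hadj, h1, h2, h3]

/-- `brokenOrd` is invariant under the global flip. [folklore] -/
theorem brokenOrd_flipAll (σ : V → Fin 2) : brokenOrd G (flipAll σ) = brokenOrd G σ := by
  rw [← brokenOrd'_eq G σ]
  unfold brokenOrd brokenOrd'
  refine Finset.sum_congr rfl fun x _ => Finset.sum_congr rfl fun y _ => ?_
  have hx : flipAll σ x = 0 ↔ σ x = 1 := flipAll_eq_zero_iff σ x
  have hy : flipAll σ y = 1 ↔ σ y = 0 := by
    unfold flipAll
    rcases Nat.lt_succ_iff_lt_or_eq.1 (Nat.lt_succ_iff.2 (Nat.lt_succ_iff.1 (σ y).isLt)) with h | h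
    · have h0 : σ y = 0 := Fin.ext (by simpa using Nat.lt_one_iff.1 h)
      simp [h0]
    · have h1 : σ y = 1 := Fin.ext (by simpa using h)
      simp [h1]
  simp only [hx, hy]

end General

/-- **the broken-bond count of a weight-8 code is that of its class representative.** [folklore] -/
theorem brokenOrd_decode_class {k : ℕ} (hk : k < 65536) (hpop : pop16 k = 8) :
    brokenOrd (torusGraph 2 4) (decode k) = brokenOrd (torusGraph 2 4) (decode (rep8 (cls k))) := by
  obtain ⟨-, hw, hact⟩ := check8_facts hk hpop
  conv_lhs => rw [← hact]
  rcases Nat.mod_two_eq_zero_or_one (wit8 k) with he | ho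
  · rw [decode_actCode_even hw he]
    exact brokenOrd_comp_iso _ (siteIso (wit8 k / 32) ((wit8 k / 2) % 16) (by omega) (Nat.mod_lt _ (by norm_num))).symm _
  · rw [decode_actCode_odd hw ho, brokenOrd_flipAll]
    exact brokenOrd_comp_iso _ (siteIso (wit8 k / 32) ((wit8 k / 2) % 16) (by omega) (Nat.mod_lt _ (by norm_num))).symm _

/-- **at the representative the broken-bond count is the kernel's `activeEdges r`.** [folklore] -/
theorem brokenOrd_decode_eq_activeEdges (u : ℕ) :
    brokenOrd (torusGraph 2 4) (decode u)
      = ((sumN 16 fun i => sumN 16 fun j => bif adj16 i j && !(Nat.testBit u i) && Nat.testBit u j then 1 else 0 : ℕ) : ℝ) := by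
  unfold brokenOrd
  rw [sumN_eq]; simp_rw [sumN_eq]
  push_cast
  rw [← sum_V4_eq]
  refine Finset.sum_congr rfl fun x _ => ?_
  rw [← sum_V4_eq]
  refine Finset.sum_congr rfl fun y _ => ?_
  simp only [decode_eq_zero_iff, decode_eq_one_iff]
  by_cases h : (torusGraph 2 4).Adj x y
  · have hb : adj16 (siteEquiv x) (siteEquiv y) = true := (adj16_iff x y).2 h
    rw [hb]
    simp only [h, true_and, Bool.true_and]
    cases Nat.testBit u (siteEquiv x) <;> cases Nat.testBit u (siteEquiv y) <;> simp
  · have hb : adj16 (siteEquiv x) (siteEquiv y) = false := by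
      cases h' : adj16 (siteEquiv x) (siteEquiv y)
      · rfl
      · exact absurd ((adj16_iff x y).1 h') h
    rw [hb]
    simp [h]

/-- `activeEdges r = brokenOrd (decode (rep8 r))`. [folklore] -/
theorem activeEdges_eq (r : ℕ) : (activeEdges r : ℝ) = brokenOrd (torusGraph 2 4) (decode (rep8 r)) := by
  unfold activeEdges; rw [brokenOrd_decode_eq_activeEdges]

/-- `isingW` on the `4 × 4` torus: `W(σ) = 8 − ½ brokenOrd σ`. [folklore] -/
theorem isingW_four (σ : Cfg) : isingW (torusGraph 2 4) σ = 8 - (1/2 : ℝ) * brokenOrd (torusGraph 2 4) σ := by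
  rw [isingW_eq, torus4_degree_sum]; norm_num

/-- **the Ising form in class variables:** `Σ_σ W(σ) a σ² = Σ_{r<58} n8 r · (8 − A_r/2) · v r²`. [folklore] -/
theorem sum_isingW_sq_eq_classes {Δ : ℝ} {a : Cfg → ℝ} (ha : IsPerronSectorGroundAmplitude 4 Δ 0 a) :
    ∑ σ, isingW (torusGraph 2 4) σ * a σ ^ 2
      = ∑ r ∈ range 58, (n8 r : ℝ) * ((8 - (1/2 : ℝ) * (activeEdges r : ℝ)) * a (decode (rep8 r)) ^ 2) := by
  rw [sum_config_eq_sum_range, ← sum_sector8]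
  refine Finset.sum_congr rfl fun k hk => ?_
  have hk' := mem_range.1 hk
  by_cases hp : pop16 k = 8
  · rw [if_pos hp, isingW_four, brokenOrd_decode_class hk' hp, ← activeEdges_eq, classValue ha hk' hp]
  · rw [if_neg hp, perron_decode_eq_zero ha hk' hp]; ring

/-! ## Energies -/

/-- the Perron amplitude's energy form on the `4 × 4` torus: `Σ a (A a + (1−Δ) W a) = E₀(Δ) + 8`. [folklore] -/
theorem perron_energy_four {Δ : ℝ} {a : Cfg → ℝ} (ha : IsPerronSectorGroundAmplitude 4 Δ 0 a) :
    ∑ σ, a σ * (fmOp (torusGraph 2 4) a σ + (1 - Δ) * (isingW (torusGraph 2 4) σ * a σ))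
      = lowestEnergyInSector 1 (xxzHamiltonian 1 (torusGraph 2 4) (-1) Δ) 0 + 8 := by
  rw [perron_energy_real ha, torus4_degree_sum]; norm_num

/-- the uniform amplitude on the sector `Sᶻ = 0`. [folklore] -/
noncomputable def unif4 (σ : Cfg) : ℝ := if zerosCard σ = 8 then 1 else 0

/-- `zerosCard (decode k) = 8 ↔ pop16 k = 8`. [folklore] -/
theorem zerosCard_decode_eq_eight_iff {k : ℕ} (hk : k < 65536) : zerosCard (decode k) = 8 ↔ pop16 k = 8 := by
  rw [zerosCard_decode, ← pop16_eq_bitCount k hk]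
  constructor
  · intro h; exact_mod_cast (by linarith : (pop16 k : ℝ) = 8)
  · intro h; rw [h]; norm_num

/-- `Σ_r n8 r = 12870`. [folklore] -/
theorem sum_n8 : ∑ r ∈ range 58, (n8 r : ℝ) = 12870 := by
  have h := n8_total; rw [sumN_eq] at h; exact_mod_cast h

/-- `Σ_r n8 r · A_r = 219648`. [folklore] -/
theorem sum_n8_activeEdges : ∑ r ∈ range 58, (n8 r : ℝ) * (activeEdges r : ℝ) = 219648 := by
  have h := brokenTotal_eq; rw [sumN_eq] at h; exact_mod_cast h

/-- **Rayleigh–Ritz with the uniform amplitude:** `E₀(Δ) + 8 ≤ −(8/15)(1 − Δ)` (every `Δ`). [folklore] -/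
theorem sectorE_le_uniform (Δ : ℝ) :
    lowestEnergyInSector 1 (xxzHamiltonian 1 (torusGraph 2 4) (-1) Δ) 0 + 8 ≤ -(8/15 : ℝ) * (1 - Δ) := by
  have hz8 : ∀ σ, unif4 σ ≠ 0 → zerosCard σ = 8 := by
    intro σ h
    by_contra hz
    unfold unif4 at h
    rw [if_neg hz] at h
    exact h rfl
  have hsupp : ∀ σ, unif4 σ ≠ 0 → zerosCard σ = (Fintype.card (TorusSite 2 4) : ℝ) / 2 + 0 := by
    intro σ h; rw [hz8 σ h, card_V4]; norm_num
  have hray := rayleigh_real (L := 4) Δ 0 unif4 hsupp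
  rw [torus4_degree_sum] at hray
  -- the graph form of a sector-constant amplitude vanishes
  have hA : ∑ σ, unif4 σ * fmOp (torusGraph 2 4) unif4 σ = 0 :=
    inner_fmOp_eq_zero_of_const (torusGraph 2 4) unif4 8 hz8
      (fun σ σ' h h' => by unfold unif4; rw [if_pos h, if_pos h'])
  -- the norm and the Ising sum of the uniform amplitude
  have hN : ∑ σ, unif4 σ ^ 2 = 12870 := by
    rw [sum_config_eq_sum_range, show (12870 : ℝ) = ∑ r ∈ range 58, (n8 r : ℝ) * 1 by simp [sum_n8],
      ← sum_sector8 (fun _ => 1)]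
    refine Finset.sum_congr rfl fun k hk => ?_
    unfold unif4
    by_cases hp : pop16 k = 8
    · rw [if_pos ((zerosCard_decode_eq_eight_iff (mem_range.1 hk)).2 hp), if_pos hp]; norm_num
    · rw [if_neg (fun h => hp ((zerosCard_decode_eq_eight_iff (mem_range.1 hk)).1 h)), if_neg hp]; norm_num
  have hW : ∑ σ, unif4 σ * ((1 - Δ) * (isingW (torusGraph 2 4) σ * unif4 σ)) = (1 - Δ) * (8 * 12870 - (1/2 : ℝ) * 219648) := by
    have h1 : ∀ σ, unif4 σ * ((1 - Δ) * (isingW (torusGraph 2 4) σ * unif4 σ)) = (1 - Δ) * (isingW (torusGraph 2 4) σ * unif4 σ ^ 2) := by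
      intro σ; ring
    simp_rw [h1]
    rw [← Finset.mul_sum]
    congr 1
    have hrhs : (8 * 12870 - (1/2 : ℝ) * 219648) = ∑ r ∈ range 58, (n8 r : ℝ) * (8 - (1/2 : ℝ) * (activeEdges r : ℝ)) := by
      rw [← sum_n8, ← sum_n8_activeEdges, Finset.mul_sum, Finset.mul_sum, ← Finset.sum_sub_distrib]
      exact Finset.sum_congr rfl fun r _ => by ring
    rw [sum_config_eq_sum_range, hrhs, ← sum_sector8 (fun r => 8 - (1/2 : ℝ) * (activeEdges r : ℝ))]
    refine Finset.sum_congr rfl fun k hk => ?_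
    have hk' := mem_range.1 hk
    unfold unif4
    by_cases hp : pop16 k = 8
    · rw [if_pos ((zerosCard_decode_eq_eight_iff hk').2 hp), if_pos hp, isingW_four, brokenOrd_decode_class hk' hp,
        ← activeEdges_eq]; ring
    · rw [if_neg (fun h => hp ((zerosCard_decode_eq_eight_iff hk').1 h)), if_neg hp]; ring
  have htot : ∑ σ, unif4 σ * (fmOp (torusGraph 2 4) unif4 σ + (1 - Δ) * (isingW (torusGraph 2 4) σ * unif4 σ))
      = (1 - Δ) * (8 * 12870 - (1/2 : ℝ) * 219648) := by
    simp_rw [mul_add]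
    rw [Finset.sum_add_distrib, hA, hW, zero_add]
  rw [htot, hN] at hray
  nlinarith [hray]


end Summit.HubbardSuperconductivity.HubbardSuperconductivity.Theorems.AnisotropyChord.FourTorus
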